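import Summits.BirchSwinnertonDyer.Rank1Residual.Additive.LocIrrTameOfKraus1997
import Summits.BirchSwinnertonDyer.Rank1Residual.X11b.PadicInertiaCharacter
import Literature.NumberTheory.GaloisRepresentations.DecompositionGroupOfCompletion
import Literature.NumberTheory.EllipticCurves.LocalKummerIsotropyTransport
import Literature.NumberTheory.EllipticCurves.SupersingularIrreducibleProofs
import HarnessLib

/-!
# `E[p]|G_{ℚ_p}` is irreducible at an odd prime of good SUPERSINGULAR reduction — Serre 1972, §1.11
# Prop. 12, LOCAL form (cell `b2b-bsdres`, lane CLASS-CLOSURE, class O5; harvest seat 2, GEN 47, E101, part 1/2)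

HONEST FRAMING (cell `b2b-bsdres`, run/shared/lean/b2b/bsd-rank1-residual/, verbatim in every
file): the goal of the cell is to DELETE the COMBINATION-SHAPED residual classes of the
Birch–Swinnerton-Dyer formula for ALL analytic-rank `≤ 1` elliptic curves over `ℚ` — "full BSD
formula for every rank `≤ 1` curve in class `C`" assembled STRICTLY from published theorems — so
that the rank-`≤ 1` remainder becomes exactly the CONSTRUCTION-SHAPED classes, which are TYPED
(missing-input `Prop`s), NOT attempted. This is not "finishing BSD". Lane CLASS-CLOSURE: research
routes; no claim beyond the stated classes; nothing is booked here; no mark of `RESIDUAL-MAP.md`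
moves. THEOREMS ONLY (no definition, no named fact, no conjecture node; net named-fact debt `0`).

## What this file does

GEN 46 (`Additive/LocIrrTameOfKraus1997.lean`, p307737) reduced the node **T-O5-CS**
`LocIrrTameIffNoCanonicalSubgroup` (cc-typer-5, p300590) to Kraus's published theorem
(`Kraus1997.propTwo_pTorsion_of_supersingular`, p307235) plus ONE classical binder `hss`: on the
O5 cell `(G) ∧ ss` at `p ≥ 5` (Kodaira `I₀*`; `E` = the quadratic twist by `p*` of a curve with GOOD
SUPERSINGULAR reduction at `p`) `E[p]|G_{ℚ_p}` is irreducible — "Serre 1972 Prop. 12 + twist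
invariance, NOT in the tree at `p ≥ 5`". This file supplies the first input, **Serre 1972, §1.11
Prop. 12 in LOCAL form**; the sibling `Additive/LocIrrOfSubGss.lean` (part 2/2) supplies the twist
invariance of `LocIrr` and discharges `hss`.

* `not_inertia_stable_line_placeOver` — for `V/ℚ` globally minimal elliptic, `p` odd, `p ∤ Δ_min`,
  `p ∣ a_p(V)`, and `𝔓` the prime of `\bar ℤ` cut out by the tree's place `placeOver p`: NO subgroup of
  order `p` of `E[p](ℚ̄)` is stable under the inertia group `I_𝔓 ≤ Γ_ℚ`. Word for word the tree's
  proof of the GLOBAL statement `hasIrreducibleModPGaloisRep_of_dvd_frobeniusTrace`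
  (`SupersingularIrreducibleProofs`, which only ever uses `I_𝔓`-stability of the rational line): the
  image of `I_𝔓` in `Aut E[p]` is cyclic of order `p² − 1` (Serre's Prop. 12 (c),
  `isCyclic_and_card_inertia_map_of_dvd_frobeniusTrace` with the tame Kummer input
  `exists_mem_inertia_smul_eq_mul_of_pow_eq`); a generator `τ` stabilising a line acts on it and on
  the quotient by scalars prime to `p`, so `τ^{p−1}` is unipotent, `τ^{p(p−1)} = 1` on `E[p]`, and
  `p² − 1 ∣ p(p − 1)` — absurd.
* `not_inertia_stable_line` — the same at EVERY prime `𝔓 ∣ p` of `\bar ℤ`: the primes above `p` are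
  conjugate under `Γ_ℚ` (`exists_smul_eq_of_mem_primesAbove_holds`, Neukirch I (9.1)) and
  `I_{g𝔓} ⊇ g I_𝔓 g⁻¹` (`conj_mem_inertia_smul_of_mem_inertia`), so an `I_{g𝔓}`-stable line is carried
  by `g⁻¹` to an `I_𝔓`-stable line.
* **`hasIrreducibleModPGaloisRep_baseChange_padic_of_dvd_frobeniusTrace`** — `(V ⊗ ℚ_p)[p]` is an
  IRREDUCIBLE `Gal(ℚ̄_p/ℚ_p)`-module; `locIrr_of_dvd_frobeniusTrace` — the cell's `LocIrr V p` at a good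
  supersingular `p ≠ 2`; `goodOrd_of_not_locIrr` — contrapositive. Transfer to `ℚ_p`: a
  `Γ_{ℚ_p}`-stable `H ≠ ⊥, ⊤` has order `p` (`#E[p] = p²`, `natCard_geomTorsion_baseChange_padic`); along
  the tree's torsion transfer `E[p](ℚ̄) ≃+ (V⁄ℚ_p)[p](ℚ̄_p)` (`torsionTransferEquiv`, equivariant for
  `res : Γ_{ℚ_p} → Γ_ℚ`) it pulls back to a line stable under `res(Γ_{ℚ_p}) = D_{𝔓₀} ⊇ I_{𝔓₀}`, where
  `𝔓₀ ∣ p` is the prime cut out by the embedding `ℚ̄ → ℚ̄_p` (Neukirch II (9.6) in the tree: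
  `decompositionSubgroup_eq_range_absGaloisRestrict`, fed with the `ℚ ⊂ ℚ_[p]` plumbing of
  `X11b/PadicInertiaCharacter.lean`: `ℚ` dense in `ℚ_p`, `‖𝓞 ℚ‖_p ≤ 1`, `‖r‖_p < 1 ↔ r ∈ (p)`,
  `0 < ‖p‖_p < 1`).

The statement proved is Serre's Prop. 12 (c) ⇒ irreducibility, read for the base change to `ℚ_p` of
a global minimal curve (the tree's supersingular-inertia theorem is stated for curves over `ℚ` at
the place `placeOver p`); nothing here is specific to the BSD cell except the name `LocIrr`.
Nothing booked; no mark moves; O5 stays OPEN.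

References: J.-P. Serre, *Propriétés galoisiennes des points d'ordre fini des courbes elliptiques*,
Invent. Math. 15 (1972) 259–331 (= Oeuvres III no. 94), §1.11 (2) Prop. 12, §1.3 Prop. 1–2, §2.1
[Serre1972]; J. Neukirch, *Algebraic Number Theory* (1999), Ch. I §9 Prop. (9.1), (9.4), Ch. II §9
Prop. (9.6) [NeukirchANT1999]; J. H. Silverman, *AEC* (2009), III.6.4, VII.5.1 [SilvermanAEC2009];
cell: HOME/b2b-bsdres-harvest-2/gen46/E100-Kraus1997-fidelity-read.md §5 (α), gen47/E101.
-/

set_option autoImplicit false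

noncomputable section

open scoped Classical NumberField Pointwise

open WeierstrassCurve Literature.NumberTheory.EllipticCurves
  Literature.NumberTheory.EllipticCurves.Rank1Residual
  Literature.NumberTheory.GaloisRepresentations Field IsDedekindDomain NumberField
  Rat.HeightOneSpectrum

namespace Summit.BirchSwinnertonDyer.Rank1Residual.Additive

/-! ## Serre 1972, §1.11 Prop. 12, local form: good supersingular `p ≥ 3` ⇒ `E[p]|G_{ℚ_p}` irreducible -/

section Serre

variable (V : WeierstrassCurve ℚ) [V.IsElliptic] [V.IsGloballyMinimal] (p : ℕ) [hp : Fact p.Prime]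

/-- **No `I_𝔓`-stable line at a supersingular prime (the place's prime).** For `V/ℚ` globally minimal
elliptic, `p` odd, `p ∤ Δ_min`, `p ∣ a_p`, and `𝔓` the prime of `\bar ℤ` above `p` cut out by the
tree's place `placeOver p`: no subgroup `Φ ≤ E[p](ℚ̄)` of order `p` is stable under the inertia group
`I_𝔓 ≤ Γ_ℚ`. Word for word the tree's proof of the global statement
(`hasIrreducibleModPGaloisRep_of_dvd_frobeniusTrace`, which only ever uses `I_𝔓`-stability): the image
of `I_𝔓` in `Aut E[p]` is cyclic of order `p² − 1` (`isCyclic_and_card_inertia_map_of_dvd_frobeniusTrace`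
with the tame Kummer input `exists_mem_inertia_smul_eq_mul_of_pow_eq`); a generator `τ` acts on `Φ`
and on `E[p]/Φ` by scalars prime to `p`, so `τ^{p−1}` is unipotent and `τ^{p(p−1)} = 1` on `E[p]`,
forcing `p² − 1 ∣ p(p − 1)`. [cite: Serre1972, §1.11 Prop. 12 (b), (c)] -/
theorem not_inertia_stable_line_placeOver (hp2 : p ≠ 2)
    (hΔ : ¬ (p : ℤ) ∣ minimalDiscriminantInt V) (hss : (p : ℤ) ∣ V.frobeniusTrace p)
    {v : HeightOneSpectrum (𝓞 ℚ)} (hv : (primesEquiv v : ℕ) = p)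
    {𝔓 : Ideal (absIntegers (𝓞 ℚ) ℚ)}
    (hmem : ∀ x : absIntegers (𝓞 ℚ) ℚ, x ∈ 𝔓 ↔ (x : AlgebraicClosure ℚ) ∈ (placeOver p).nonunits)
    (h𝔓 : 𝔓 ∈ v.primesAbove)
    {Φ : AddSubgroup (geomTorsion V (p : ℤ))} (hΦ : Nat.card Φ = p)
    (hstab : ∀ s ∈ 𝔓.inertia (absoluteGaloisGroup ℚ), ∀ P ∈ Φ, s • P ∈ Φ) : False := by
  have hpp : p.Prime := hp.out
  -- the cyclic image of inertia and a generator `τ ∈ I_𝔓`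
  have hT : ∀ π ζ : AlgebraicClosure ℚ, π ^ (p ^ 2 - 1) = p → ζ ^ (p ^ 2 - 1) = 1 →
      ∃ s ∈ 𝔓.inertia (absoluteGaloisGroup ℚ), s • π = ζ * π := fun π ζ hπ hζ ↦
    exists_mem_inertia_smul_eq_mul_of_pow_eq p
      (Nat.sub_pos_of_lt (Nat.one_lt_pow two_ne_zero hpp.one_lt)) hv h𝔓 hπ hζ
  obtain ⟨hcyc, hcard⟩ := isCyclic_and_card_inertia_map_of_dvd_frobeniusTrace p hΔ hss hp2 hmem hT
  set G := (𝔓.inertia (absoluteGaloisGroup ℚ)).map (galoisRepTorsion V (p : ℤ)) with hGdef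
  haveI := hcyc
  obtain ⟨g, hg⟩ := IsCyclic.exists_ofOrder_eq_natCard (α := G)
  obtain ⟨τ, hτI, hτg⟩ := Subgroup.mem_map.mp g.2
  have hordτ : orderOf (galoisRepTorsion V (p : ℤ) τ) = p ^ 2 - 1 := by
    rw [hτg, Subgroup.orderOf_coe, hg, hcard]
  -- scalars on `Φ` and on `E[p]/Φ`
  have hE := Rank1Residual.natCard_geomTorsion V p
  have hstabτ : ∀ P ∈ Φ, τ • P ∈ Φ := hstab τ hτI
  obtain ⟨k, hk⟩ := exists_smul_eq_zsmul_of_stable hΦ hstabτ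
  obtain ⟨d, hd⟩ := exists_smul_sub_zsmul_mem_of_stable hΦ hE hstabτ
  -- `k` and `d` are prime to `p`
  haveI : Finite Φ := Nat.finite_of_card_ne_zero (by rw [hΦ]; exact hpp.ne_zero)
  have hnt : 1 < Nat.card Φ := by rw [hΦ]; exact hpp.one_lt
  haveI : Nontrivial Φ := Finite.one_lt_card_iff_nontrivial.mp hnt
  obtain ⟨⟨P₀, hP₀⟩, hP₀0⟩ := exists_ne (0 : Φ)
  have hP₀0' : P₀ ≠ 0 := fun h ↦ hP₀0 (Subtype.ext h)
  have hptor : ∀ P : geomTorsion V (p : ℤ), ((p : ℕ) : ℤ) • P = 0 := fun P ↦ by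
    rw [← Subtype.coe_inj, AddSubgroupClass.coe_zsmul, ZeroMemClass.coe_zero]
    exact (Submodule.mem_torsionBy_iff _ _).mp P.2
  have hkp : ¬ (p : ℤ) ∣ k := by
    rintro ⟨c, rfl⟩
    have h := hk P₀ hP₀
    rw [mul_comm, mul_smul, hptor, smul_zero] at h
    exact hP₀0' ((smul_eq_zero_iff_eq τ).mp h)
  have hdp : ¬ (p : ℤ) ∣ d := by
    rintro ⟨c, rfl⟩
    -- then `τ • P ∈ Φ` for all `P`, so `Φ = ⊤`: contradiction with `#Φ = p < p²`
    have hall : ∀ P : geomTorsion V (p : ℤ), τ • P ∈ Φ := fun P ↦ by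
      have h := hd P
      rwa [mul_comm, mul_smul, hptor, smul_zero, sub_zero] at h
    have htop : Φ = ⊤ := by
      refine eq_top_iff.mpr fun P _ ↦ ?_
      have := hall (τ⁻¹ • P)
      rwa [smul_inv_smul] at this
    have := hΦ
    rw [htop, AddSubgroup.card_top, hE, pow_two] at this
    exact absurd this (by nlinarith [hpp.one_lt])
  -- Fermat: `k^{p-1} ≡ 1`, `d^{p-1} ≡ 1 (mod p)`
  have hpi : Prime (p : ℤ) := Nat.prime_iff_prime_int.mp hpp
  have hfermat : ∀ m : ℤ, ¬ (p : ℤ) ∣ m →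
      ∀ P : geomTorsion V (p : ℤ), (m ^ (p - 1)) • P = P := by
    intro m hm P
    have h1 : m ^ (p - 1) ≡ 1 [ZMOD p] :=
      Int.ModEq.pow_card_sub_one_eq_one hpp ((hpi.coprime_iff_not_dvd.mpr hm).symm)
    obtain ⟨c, hc⟩ := (Int.modEq_iff_dvd.mp h1.symm)
    have h2 : m ^ (p - 1) = 1 + (p : ℤ) * c := by linarith
    rw [h2, add_smul, one_smul, mul_comm, mul_smul, hptor, smul_zero, add_zero]
  -- `τ^{p-1}` is unipotent
  have hfix : ∀ P ∈ Φ, (τ ^ (p - 1)) • P = P := fun P hP ↦ by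
    rw [pow_smul_eq_pow_zsmul hk (p - 1) P hP, hfermat k hkp P]
  have hquot : ∀ P : geomTorsion V (p : ℤ), (τ ^ (p - 1)) • P - P ∈ Φ := fun P ↦ by
    have h := pow_smul_sub_pow_zsmul_mem hstabτ hd (p - 1) P
    rwa [hfermat d hdp P] at h
  -- so `τ^{(p-1)p}` is trivial on `E[p]`
  have htriv : ∀ P : geomTorsion V (p : ℤ), (τ ^ ((p - 1) * p)) • P = P := fun P ↦ by
    rw [pow_mul]; exact pow_prime_smul_eq_self_of_unipotent hfix hquot P
  have hone : galoisRepTorsion V (p : ℤ) (τ ^ ((p - 1) * p)) = 1 :=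
    (galoisRepTorsion_eq_one_iff' V (p : ℤ) _).mpr htriv
  rw [map_pow] at hone
  have hdvd : p ^ 2 - 1 ∣ (p - 1) * p := hordτ ▸ orderOf_dvd_of_pow_eq_one hone
  -- `p² - 1 ∣ p(p-1)` is absurd
  have hpos : 0 < (p - 1) * p := Nat.mul_pos (by have := hpp.two_le; omega) hpp.pos
  have hle := Nat.le_of_dvd hpos hdvd
  have h2 := hpp.two_le
  have : p ^ 2 - 1 > (p - 1) * p := by
    have : (p - 1) * p = p ^ 2 - p := by rw [pow_two, Nat.sub_mul, one_mul]
    rw [this]; omega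
  omega

/-- `I_{g • 𝔓} ⊇ g I_𝔓 g⁻¹`: inertia groups of conjugate primes are conjugate (Neukirch I §9 (9.4);
the tree's `DegreeOnePrimesFixedField.conj_mem_inertia_of_mem_inertia_smul`, restated in the
direction used here). [folklore] -/
theorem conj_mem_inertia_smul_of_mem_inertia {𝔓 : Ideal (absIntegers (𝓞 ℚ) ℚ)}
    {g s : absoluteGaloisGroup ℚ} (hs : s ∈ 𝔓.inertia (absoluteGaloisGroup ℚ)) :
    g * s * g⁻¹ ∈ (g • 𝔓).inertia (absoluteGaloisGroup ℚ) := by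
  intro x
  rw [Submodule.mem_toAddSubgroup, Ideal.mem_pointwise_smul_iff_inv_smul_mem, smul_sub, mul_smul,
    mul_smul, inv_smul_smul]
  exact hs (g⁻¹ • x)

/-- **No `I_𝔓`-stable line at a supersingular prime, for EVERY prime `𝔓 ∣ p` of `\bar ℤ`.** The primes
above `p` are conjugate under `Γ_ℚ` (`exists_smul_eq_of_mem_primesAbove_holds`, Neukirch I (9.1)) and
`I_{g𝔓} ⊇ g I_𝔓 g⁻¹`, so a line stable under `I_{g𝔓}` is carried by `g⁻¹` to a line stable under `I_𝔓`.
[cite: Serre1972, §1.11 Prop. 12 (b), (c)] [cite: NeukirchANT1999, Ch. I §9 Prop. (9.1)] -/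
theorem not_inertia_stable_line (hp2 : p ≠ 2)
    (hΔ : ¬ (p : ℤ) ∣ minimalDiscriminantInt V) (hss : (p : ℤ) ∣ V.frobeniusTrace p)
    {v : HeightOneSpectrum (𝓞 ℚ)} (hv : (primesEquiv v : ℕ) = p)
    {𝔓 : Ideal (absIntegers (𝓞 ℚ) ℚ)} (h𝔓 : 𝔓 ∈ v.primesAbove)
    {Φ : AddSubgroup (geomTorsion V (p : ℤ))} (hΦ : Nat.card Φ = p)
    (hstab : ∀ s ∈ 𝔓.inertia (absoluteGaloisGroup ℚ), ∀ P ∈ Φ, s • P ∈ Φ) : False := by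
  obtain ⟨𝔓₁, hmem, h𝔓₁⟩ := exists_ideal_placeOver p hv
  obtain ⟨g, hg⟩ :=
    HeightOneSpectrum.exists_smul_eq_of_mem_primesAbove_holds (K := ℚ) (v := v) h𝔓₁ h𝔓
  -- `Φ₁ = g⁻¹ Φ = {P | g • P ∈ Φ}`
  let Φ₁ : AddSubgroup (geomTorsion V (p : ℤ)) :=
    Φ.comap (DistribSMul.toAddMonoidHom (geomTorsion V (p : ℤ)) g)
  have hmemΦ₁ : ∀ P, P ∈ Φ₁ ↔ g • P ∈ Φ := fun P ↦ Iff.rfl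
  have hΦ₁ : Nat.card Φ₁ = p :=
    (Nat.card_congr
      { toFun := fun P ↦ ⟨g • P.1, (hmemΦ₁ P.1).mp P.2⟩
        invFun := fun Q ↦ ⟨g⁻¹ • Q.1, by rw [hmemΦ₁, smul_inv_smul]; exact Q.2⟩
        left_inv := fun P ↦ Subtype.ext (inv_smul_smul g P.1)
        right_inv := fun Q ↦ Subtype.ext (smul_inv_smul g Q.1) : Φ₁ ≃ Φ }).trans hΦ
  have hstab₁ : ∀ s ∈ 𝔓₁.inertia (absoluteGaloisGroup ℚ), ∀ P ∈ Φ₁, s • P ∈ Φ₁ := by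
    intro s hs P hP
    rw [hmemΦ₁] at hP ⊢
    have hconj : g * s * g⁻¹ ∈ 𝔓.inertia (absoluteGaloisGroup ℚ) := by
      rw [← hg]; exact conj_mem_inertia_smul_of_mem_inertia hs
    have h := hstab _ hconj _ hP
    rwa [mul_smul, mul_smul, inv_smul_smul] at h
  exact not_inertia_stable_line_placeOver V p hp2 hΔ hss hv hmem h𝔓₁ hΦ₁ hstab₁

/-- **Serre 1972, §1.11 Prop. 12, LOCAL form: at an odd prime of good SUPERSINGULAR reduction
`E[p]` is an irreducible `Gal(ℚ̄_p/ℚ_p)`-module.** For `V/ℚ` globally minimal elliptic, `p ≠ 2`,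
`p ∤ Δ_min(V)`, `p ∣ a_p(V)`: `(V ⊗ ℚ_p).HasIrreducibleModPGaloisRep p`. A `Γ_{ℚ_p}`-stable subgroup
`H ≠ ⊥, ⊤` of `(V⁄ℚ_p)[p](ℚ̄_p)` has order `p` (`#E[p] = p²`); its preimage under the torsion transfer
`E[p](ℚ̄) ≃+ (V⁄ℚ_p)[p](ℚ̄_p)` (`torsionTransferEquiv`, `res`-equivariant) is a line stable under
`res(Γ_{ℚ_p}) = D_{𝔓₀}` (`decompositionSubgroup_eq_range_absGaloisRestrict`, Neukirch II (9.6), for the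
prime `𝔓₀ ∣ p` of `\bar ℤ` cut out by `ℚ̄ → ℚ̄_p`), hence under `I_{𝔓₀}` — impossible by
`not_inertia_stable_line`. Serre, §1.11 (2) Prop. 12 ("bonne réduction de hauteur 2", `e = 1`):
"c) L'image de `I` dans `GL(E_p)` est un groupe cyclique `C` d'ordre `p² − 1` («sous-groupe de Cartan
non déployé», cf. n° 2.1)" — such a `C` leaves no line of `E_p` stable, so `E_p` is an irreducible
`I`-module, a fortiori an irreducible `G = Gal(ℚ̄_p/ℚ_p)`-module (Oeuvres III no. 94, Invent. Math. 15
(1972) 259–331). [cite: Serre1972, §1.11 Prop. 12 (c)] [cite: NeukirchANT1999, Ch. II §9 Prop. (9.6)] -/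
theorem hasIrreducibleModPGaloisRep_baseChange_padic_of_dvd_frobeniusTrace (hp2 : p ≠ 2)
    (hΔ : ¬ (p : ℤ) ∣ minimalDiscriminantInt V) (hss : (p : ℤ) ∣ V.frobeniusTrace p) :
    (V.baseChange ℚ_[p]).HasIrreducibleModPGaloisRep p := by
  have hpp : p.Prime := hp.out
  -- the place `v` at `p` and the prime `𝔓₀ ∣ v` cut out by the embedding `ℚ̄ → ℚ̄_p`
  set v : HeightOneSpectrum (𝓞 ℚ) := primesEquiv.symm ⟨p, hpp⟩ with hvdef
  have hv : (primesEquiv v : ℕ) = p := by rw [hvdef, Equiv.apply_symm_apply]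
  have hO := X11b.PadicInertiaCharacter.norm_algebraMap_ringOfIntegers_le_one p
  obtain ⟨𝔓₀, h𝔓₀⟩ := exists_ideal_forall_mem_iff_spectralNorm_lt_one ℚ ℚ_[p] hO
  have h𝔓₀v : 𝔓₀ ∈ v.primesAbove :=
    mem_primesAbove_of_forall_mem_iff v
      (X11b.PadicInertiaCharacter.norm_algebraMap_ringOfIntegers_lt_one_iff p v hv) 𝔓₀ h𝔓₀
  have hD : 𝔓₀.decompositionSubgroup (absoluteGaloisGroup ℚ) =
      (absGaloisRestrict ℚ ℚ_[p]).toMonoidHom.range :=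
    decompositionSubgroup_eq_range_absGaloisRestrict
      (X11b.PadicInertiaCharacter.denseRange_algebraMap p) hO
      (X11b.PadicInertiaCharacter.exists_norm_algebraMap_lt_one p) 𝔓₀ h𝔓₀
  -- a stable subgroup `H ≠ ⊥, ⊤` of the local module has order `p`
  intro H hH
  by_contra hne
  rw [not_or] at hne
  obtain ⟨hbot, htop⟩ := hne
  have hcardE := natCard_geomTorsion_baseChange_padic V p
  haveI : Finite (geomTorsion (V.baseChange ℚ_[p]) (p : ℤ)) :=
    Nat.finite_of_card_ne_zero (by rw [hcardE]; exact pow_ne_zero 2 hpp.ne_zero)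
  have hcardH : Nat.card H = p := by
    have hdvd : Nat.card H ∣ p ^ 2 := hcardE ▸ H.card_addSubgroup_dvd_card
    obtain ⟨i, hi, hHi⟩ := (Nat.dvd_prime_pow hpp).mp hdvd
    interval_cases i
    · exact absurd (AddSubgroup.card_eq_one.mp (by simpa using hHi)) hbot
    · simpa using hHi
    · exact absurd ((AddSubgroup.card_eq_iff_eq_top H).mp (by rw [hHi, hcardE])) htop
  -- transfer to `E[p](ℚ̄)`
  have hp0 : (p : ℤ) ≠ 0 := by exact_mod_cast hpp.ne_zero
  let t := V.torsionTransferEquiv (E := ℚ_[p]) hp0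
  let Φ : AddSubgroup (geomTorsion V (p : ℤ)) := H.comap t.toAddMonoidHom
  have hmemΦ : ∀ P, P ∈ Φ ↔ t P ∈ H := fun P ↦ Iff.rfl
  have hΦ : Nat.card Φ = p :=
    (Nat.card_congr
      { toFun := fun P ↦ ⟨t P.1, (hmemΦ P.1).mp P.2⟩
        invFun := fun Q ↦ ⟨t.symm Q.1, by rw [hmemΦ, t.apply_symm_apply]; exact Q.2⟩
        left_inv := fun P ↦ Subtype.ext (t.symm_apply_apply P.1)
        right_inv := fun Q ↦ Subtype.ext (t.apply_symm_apply Q.1) : Φ ≃ H }).trans hcardH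
  -- `Φ` is stable under `I_{𝔓₀} ≤ D_{𝔓₀} = res (Γ_{ℚ_p})`
  have hstab : ∀ s ∈ 𝔓₀.inertia (absoluteGaloisGroup ℚ), ∀ P ∈ Φ, s • P ∈ Φ := by
    intro s hs P hP
    have hsD : s ∈ 𝔓₀.decompositionSubgroup (absoluteGaloisGroup ℚ) :=
      Ideal.inertia_le_decompositionSubgroup _ _ hs
    rw [hD] at hsD
    obtain ⟨σ, hσ⟩ := MonoidHom.mem_range.mp hsD
    rw [hmemΦ] at hP ⊢
    rw [← hσ]
    change t (absGaloisRestrict ℚ ℚ_[p] σ • P) ∈ H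
    rw [V.torsionTransferEquiv_smul (E := ℚ_[p]) hp0 σ P]
    exact hH σ _ hP
  exact not_inertia_stable_line V p hp2 hΔ hss hv h𝔓₀v hΦ hstab

/-- **At an odd prime of good supersingular reduction, `LocIrr` holds**: `p ≠ 2`, `V` good at `p`,
`p ∣ a_p(V)` ⇒ `E[p]|G_{ℚ_p}` irreducible. [cite: Serre1972, §1.11 Prop. 12] -/
theorem locIrr_of_dvd_frobeniusTrace (hp2 : p ≠ 2) (hgood : V.HasGoodReductionAtPrime p)
    (hss : (p : ℤ) ∣ V.frobeniusTrace p) : LocIrr V p :=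
  hasIrreducibleModPGaloisRep_baseChange_padic_of_dvd_frobeniusTrace V p hp2
    (V.not_dvd_minimalDiscriminantInt_of_hasGoodReductionAtPrime' p hgood) hss

/-- Contrapositive bookkeeping: a good prime `p ≠ 2` at which `E[p]|G_{ℚ_p}` is REDUCIBLE is ordinary
(`GoodOrd`). [cite: Serre1972, §1.11 Prop. 12] -/
theorem goodOrd_of_not_locIrr (hp2 : p ≠ 2) (hgood : V.HasGoodReductionAtPrime p)
    (hred : ¬ LocIrr V p) : GoodOrd V p :=
  ⟨hgood, fun hss ↦ hred (locIrr_of_dvd_frobeniusTrace V p hp2 hgood hss)⟩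

end Serre

end Summit.BirchSwinnertonDyer.Rank1Residual.Additive

end
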